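import Summits.Ventures.Crystal3D.Theorems.StickyWulffConstantTextureBuildTentLine
import Summits.Ventures.Crystal3D.Theorems.StickyWulffConstantTextureLiminfTexShadowSplitDefsV5
import Summits.Ventures.Crystal3D.Theorems.StickyWulffConstantGenericWallFloorAffineSampleDeficit
import Summits.Ventures.Crystal3D.StickySpheres.FinsetBridge
import HarnessLib

/-!
# TB-1: the pieces of the CERTIFIED CELL COVER — tent pieces, wall cells (model position), placed cells — and their per-piece budget lines
# (lane T, crux `TextureLiminfV5`, stmt-Ventures-23912; `stub_textureBuild` → TB-0.md §2.5 / §2 TB-C; cf-p1 DECISION (cxiii) «CellCover → TB-C», 2026-08-29T05:13:29Z)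

HONEST FRAMING. Venture `Summits/Ventures/Crystal3D` (cell `crystal3d-full`), route `route-Ventures-StickyWulffConstant`, helper `--supports` the
law-v5 crux `TextureLiminfV5` (stmt-Ventures-23912).  DEFINITIONS (the interface structures of TB-0's level-2 split) + pure finite combinatorics (census-free,
standard axioms).  No cover is constructed, no texture is built, no cell inequality is proved; rung F-C1 not moved.

THE INTERFACE (TB-0.md §2.5, frozen here for tents and wall cells; crust cells and the gap set are part 2).
* `TentPiece` — one grain's tent data in ACTUAL position: a moved Barlow stacking `S = stacking L s σ`, the finite TENT SET `Xh ⊆ S` (grain atoms + phantoms,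
  TB-0.md §6) and the open free zone `U`; `budget := ½·brokenNearIn S Xh U` (what `BarlowFreeCertificate` certifies), `owned X' := ` the REAL tent balls within
  `√2` of `U`, `rim X'` := half the bonds from owned balls to balls outside `Xh` plus half the vacant-site counts of PHANTOMS near `U`.
* `WallCell C R₀` — one clamped wall cell in the MODEL position of `BilayerWallAt` (two presented plates, bilayer frames, a `13/25`-admissible law table, gap
  `h`, radius `ρ ≥ R₀`, balls `X` with the complete plates `P₁, P₂`): `charge` (the `∑'` term), `budget` (RHS − LHS without charge and rim), `rim := C(1+h)ρ`;
  **`WallCell.charge_le`**: the `∀`-body of `BilayerWallCharged (13/25)` at `(C, R₀)` gives `charge ≤ budget + rim`.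
* `PlacedCell C R₀ X'` — a `WallCell` together with the rigid motion `p ↦ M p + t` that PLACES it in the configuration: `X.image φ ⊆ X'`; `act` = its balls in
  actual position, `tilingRim` := half the filling's and the plates' bonds to filling-like balls outside the cell (model-side expression).
* `CellCover C R₀ N x` — the filled configuration `x' ⊇ x` (`Def' ≤ Def`), finitely many tent pieces and placed cells whose OWNED ball sets are pairwise disjoint
  subsets of `X' = range x'`; `tilingLoss := Σ tent rims + Σ cell tiling rims`.
PER-PIECE LINES proved here: `TentPiece.budget_le` (tent line `brokenNearIn_le_sum_halfDefect`), `WallCell.charge_le` (the wall law), `PlacedCell.budget_le`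
(wall-cell line `wallBudget_le_sum_halfDefect` transported by rigid-motion covariance of `cdeg` / `halfDefect` / `crossCount`; `R₀ ≥ 1` makes the two plates
contact-free).  The structure `CellCover` and the tiling identity `CellCover.tiling` are the sequel file `…TextureBuildCellCover`.
WHAT THIS IS NOT: crust cells, the gap set `Γ`, the texture-side clauses of TB-D (part 2); no cover is exhibited; F-C1 not moved.
-/

noncomputable section

open scoped BigOperators InnerProductSpace ENNReal
open MeasureTheory

namespace Summit.Ventures.Crystal3D.Cruxes.TextureLiminf.TexShadow

open Summit.Ventures.Crystal3D Summit.Ventures.Crystal3D.Theorems Finset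
open Literature.MathematicalPhysics.StatisticalMechanics (IsHaggSeq fccStacking barlowStacking contactDeficiency orderedContacts)

/-! ## Rigid-motion covariance of the counting vocabulary -/

section Covariance

variable (M : E3 ≃ₗᵢ[ℝ] E3) (t : E3)

/-- the rigid motion `p ↦ M p + t` -/
def rigid (M : E3 ≃ₗᵢ[ℝ] E3) (t : E3) : E3 → E3 := fun p => M p + t

/-- A rigid motion is an isometry. -/
theorem rigid_isometry : Isometry (rigid M t) := fun p q => by
  simp only [rigid, edist_dist, dist_eq_norm, add_sub_add_right_eq_sub, ← map_sub, LinearIsometryEquiv.norm_map]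

/-- A rigid motion is injective. -/
theorem rigid_injective : Function.Injective (rigid M t) := (rigid_isometry M t).injective

/-- A rigid motion preserves distances. -/
theorem dist_rigid (p q : E3) : dist (rigid M t p) (rigid M t q) = dist p q := (rigid_isometry M t).dist_eq p q

/-- the inverse motion -/
theorem rigid_symm_apply (p : E3) : rigid M t (M.symm (p - t)) = p := by
  simp [rigid]

/-- The inverse motion undoes the motion. -/
theorem symm_rigid_apply (p : E3) : M.symm (rigid M t p - t) = p := by
  simp [rigid]

/-- A moved stacking moves to a moved stacking. -/
theorem image_rigid_stacking (L : E3 ≃ₗᵢ[ℝ] E3) (s : E3) (σ : ℤ → ℤ) :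
    rigid M t '' stacking L s σ = stacking (L.trans M) (M s + t) σ := by
  ext p
  simp only [stacking, Set.mem_image, rigid, LinearIsometryEquiv.coe_trans, Function.comp_apply]
  constructor
  · rintro ⟨q, ⟨r, hr, rfl⟩, rfl⟩
    exact ⟨r, hr, by simp [map_add, add_assoc]⟩
  · rintro ⟨r, hr, rfl⟩
    exact ⟨L r + s, ⟨r, hr, rfl⟩, by simp [map_add, add_assoc]⟩

/-- Degrees are rigid-motion covariant. -/
theorem cdeg_image_rigid (Y : Finset E3) (a : E3) : cdeg (Y.image (rigid M t)) (rigid M t a) = cdeg Y a := by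
  classical
  unfold cdeg
  have h : (Y.image (rigid M t)).filter (fun q => dist (rigid M t a) q = 1) = (Y.filter fun q => dist a q = 1).image (rigid M t) := by
    ext q
    simp only [Finset.mem_filter, Finset.mem_image]
    constructor
    · rintro ⟨⟨p, hp, rfl⟩, hd⟩
      exact ⟨p, ⟨hp, by rwa [dist_rigid] at hd⟩, rfl⟩
    · rintro ⟨p, ⟨hp, hd⟩, rfl⟩
      exact ⟨⟨p, hp, rfl⟩, by rwa [dist_rigid]⟩
  rw [h, Finset.card_image_of_injective _ (rigid_injective M t)]

/-- Half-defects are rigid-motion covariant. -/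
theorem halfDefect_image_rigid (Y : Finset E3) (a : E3) : halfDefect (Y.image (rigid M t)) (rigid M t a) = halfDefect Y a := by
  unfold halfDefect; rw [cdeg_image_rigid]

/-- Cross counts are rigid-motion covariant. -/
theorem crossCount_image_rigid (A B : Finset E3) : crossCount (A.image (rigid M t)) (B.image (rigid M t)) = crossCount A B := by
  classical
  rw [crossCount_eq_sum, crossCount_eq_sum, Finset.sum_image fun p _ q _ h => rigid_injective M t h]
  refine Finset.sum_congr rfl fun a _ => ?_
  have := cdeg_image_rigid M t B a
  unfold cdeg at this
  exact this

end Covariance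

/-! ## Tent pieces -/

/-- **A TENT PIECE** (actual position): a grain's moved stacking, its finite tent set `Xh ⊆ S` and its open free zone `U`. -/
structure TentPiece where
  /-- frame, origin, Hägg word of the grain's stacking -/
  L : E3 ≃ₗᵢ[ℝ] E3
  s : E3
  σ : ℤ → ℤ
  hσ : IsHaggSeq σ
  /-- the tent set (grain atoms ∪ phantoms), on the stacking -/
  Xh : Finset E3
  hXh : (↑Xh : Set E3) ⊆ stacking L s σ
  /-- the open free zone -/
  U : Set E3
  hU : IsOpen U

namespace TentPiece

/-- the certified quantity: `½·brokenNearIn S Xh U`. -/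
def budget (T : TentPiece) : ℝ := (brokenNearIn (stacking T.L T.s T.σ) T.Xh T.U : ℝ) / 2

open scoped Classical in
/-- the REAL tent balls within `√2` of the free zone (these pay). -/
def owned (T : TentPiece) (X' : Finset E3) : Finset E3 :=
  (T.Xh ∩ X').filter fun a => Metric.infDist a T.U ≤ Real.sqrt 2

open scoped Classical in
/-- the tent piece's RIM: half the owned balls' bonds to balls outside the tent set, plus half the vacant-site counts of the phantoms near `U`. -/
def rim (T : TentPiece) (X' : Finset E3) : ℝ :=
  (crossCount (T.owned X') (X' \ T.Xh) : ℝ) / 2 +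
    (∑ a ∈ (T.Xh \ X').filter (fun a => Metric.infDist a T.U ≤ Real.sqrt 2), ((12 : ℝ) - (cdeg T.Xh a : ℝ))) / 2

/-- Owned balls are balls of the configuration. -/
theorem owned_subset (T : TentPiece) (X' : Finset E3) : T.owned X' ⊆ X' := by
  classical
  intro a ha
  unfold owned at ha
  exact (Finset.mem_inter.1 (Finset.mem_filter.1 ha).1).2

/-- **The tent line, per piece**: `budget ≤ Σ_{owned} halfDefect X' + rim`. -/
theorem budget_le (T : TentPiece) (X' : Finset E3) : T.budget ≤ ∑ a ∈ T.owned X', halfDefect X' a + T.rim X' := by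
  classical
  have h := brokenNearIn_le_sum_halfDefect T.hσ T.hXh X' T.U
  have h2 : ∑ a ∈ (T.Xh ∩ X').filter (fun a => Metric.infDist a T.U ≤ Real.sqrt 2), 2 * halfDefect X' a =
      2 * ∑ a ∈ (T.Xh ∩ X').filter (fun a => Metric.infDist a T.U ≤ Real.sqrt 2), halfDefect X' a := by
    rw [Finset.mul_sum]
  rw [h2] at h
  unfold budget rim owned
  linarith

end TentPiece

/-! ## Wall cells in model position -/

/-- **One clamped WALL CELL in model position** with explicit constants `(C, R₀)`: exactly the data and hypotheses that the `∀`-body of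
`BilayerWallCharged (13/25)` consumes. -/
structure WallCell (C R₀ : ℝ) where
  /-- Hägg words of the two plates -/
  σ₁ : ℤ → ℤ
  σ₂ : ℤ → ℤ
  hσ₁ : IsHaggSeq σ₁
  hσ₂ : IsHaggSeq σ₂
  /-- presentations -/
  L₁ : E3 ≃ₗᵢ[ℝ] E3
  L₂ : E3 ≃ₗᵢ[ℝ] E3
  s₁ : E3
  s₂ : E3
  /-- bilayer frames -/
  A₁ : ℤ → (E3 ≃ₗᵢ[ℝ] E3)
  A₂ : ℤ → (E3 ≃ₗᵢ[ℝ] E3)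
  hA₁ : ∀ i, ∃ u : E3, bilayer L₁ s₁ σ₁ i ⊆ (fun r => A₁ i r + u) '' fccRef
  hA₂ : ∀ j, ∃ u : E3, bilayer L₂ s₂ σ₂ j ⊆ (fun r => A₂ j r + u) '' fccRef
  /-- the LAW table of the cell (admissible at cap `13/25` by construction) -/
  c : ℤ → ℤ → ℝ
  m : ℤ → ℤ → E3
  hadm : BilayerChargeAdmissibleAt (13 / 25) A₁ A₂ c m
  /-- geometry -/
  h : ℝ
  ρ : ℝ
  hh : 0 ≤ h
  hρ : R₀ ≤ ρ
  /-- the cell's balls and plates -/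
  X : Finset E3
  P₁ : Finset E3
  P₂ : Finset E3
  hX : ∀ p ∈ X, ∀ q ∈ X, p ≠ q → 1 ≤ dist p q
  hP₁ : P₁ ⊆ X
  hP₂ : P₂ ⊆ X \ P₁
  hcyl : ∀ p ∈ X, p ∈ cyl R₀ h ρ
  hP₁iff : ∀ p, p ∈ P₁ ↔ (p ∈ stacking L₁ s₁ σ₁ ∧ -(2 * R₀) ≤ p 2 ∧ p 2 ≤ -R₀ ∧ p 0 ^ 2 + p 1 ^ 2 ≤ ρ ^ 2)
  hP₂iff : ∀ p, p ∈ P₂ ↔ (p ∈ stacking L₂ s₂ σ₂ ∧ h + R₀ ≤ p 2 ∧ p 2 ≤ h + 2 * R₀ ∧ p 0 ^ 2 + p 1 ^ 2 ≤ ρ ^ 2)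

namespace WallCell

variable {C R₀ : ℝ}

/-- the CHARGE term of the cell (verbatim from `BilayerWallAt`). -/
def charge (k : WallCell C R₀) : ℝ :=
  ∑' ij : ℤ × ℤ, k.c ij.1 ij.2 *
    (volume ({q : E3 | 0 ≤ q 2 ∧ q 2 ≤ 1 ∧ q 0 ^ 2 + q 1 ^ 2 ≤ k.ρ ^ 2} ∩
      laySlab k.L₁ k.s₁ ij.1 ∩ laySlab k.L₂ k.s₂ ij.2)).toReal

/-- the filling -/
def F (k : WallCell C R₀) : Finset E3 := (k.X \ k.P₁) \ k.P₂

/-- the BUDGET of the cell: RHS − LHS of `BilayerWallAt` without charge and rim. -/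
def budget (k : WallCell C R₀) : ℝ :=
  contactDeficiency k.F +
    1 / 2 * innerBonds (stacking k.L₁ k.s₁ k.σ₁) k.P₁ (fun q => -R₀ < q 2) +
    1 / 2 * innerBonds (stacking k.L₂ k.s₂ k.σ₂) k.P₂ (fun q => q 2 < k.h + R₀) -
    (crossCount k.P₁ (k.X \ k.P₁) : ℝ) - (crossCount k.P₂ k.F : ℝ)

/-- the RIM term `C(1+h)ρ`. -/
def rim (k : WallCell C R₀) : ℝ := C * (1 + k.h) * k.ρ

/-- **The wall law prices the cell**: `charge ≤ budget + rim`. -/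
theorem charge_le
    (hW : ∀ (σ₁ σ₂ : ℤ → ℤ), IsHaggSeq σ₁ → IsHaggSeq σ₂ →
      ∀ (L₁ L₂ : E3 ≃ₗᵢ[ℝ] E3) (s₁ s₂ : E3) (A₁ A₂ : ℤ → (E3 ≃ₗᵢ[ℝ] E3)),
      (∀ i, ∃ u : E3, bilayer L₁ s₁ σ₁ i ⊆ (fun r => A₁ i r + u) '' fccRef) →
      (∀ j, ∃ u : E3, bilayer L₂ s₂ σ₂ j ⊆ (fun r => A₂ j r + u) '' fccRef) →
      ∀ (c : ℤ → ℤ → ℝ) (m : ℤ → ℤ → E3), (∀ i j, 0 ≤ c i j) → (∀ i j, c i j ≤ 13 / 25) →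
      (∀ i j, CoAx (A₁ i) (A₂ j) → A₁ i '' fccRef ≠ A₂ j '' fccRef →
        SharedAxis (m i j) (A₁ i) (A₂ j) ∧ c i j ≤ 1 / 2 * Real.sqrt (1 - ⟪m i j, e₃⟫_ℝ ^ 2)) →
      (∀ i j, A₁ i '' fccRef = A₂ j '' fccRef → c i j = 0) →
      BilayerWallAt C R₀ σ₁ σ₂ L₁ L₂ s₁ s₂ c)
    (k : WallCell C R₀) : k.charge ≤ k.budget + k.rim := by
  have hcell := hW k.σ₁ k.σ₂ k.hσ₁ k.hσ₂ k.L₁ k.L₂ k.s₁ k.s₂ k.A₁ k.A₂ k.hA₁ k.hA₂ k.c k.m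
    k.hadm.1 k.hadm.2.1 k.hadm.2.2.1 k.hadm.2.2.2 k.h k.hh k.ρ k.hρ k.X k.P₁ k.P₂ k.hX k.hP₁ k.hP₂ k.hcyl k.hP₁iff k.hP₂iff
  simp only [charge, budget, rim, F, crossCount]
  linarith

/-- Plate 1 balls are not beyond their inner face. -/
theorem not_beyond₁ (k : WallCell C R₀) : ∀ p ∈ k.P₁, ¬ (-R₀ < p 2) := fun p hp h => by
  have := ((k.hP₁iff p).1 hp).2.2.1; linarith

/-- Plate 2 balls are not beyond their inner face. -/
theorem not_beyond₂ (k : WallCell C R₀) : ∀ p ∈ k.P₂, ¬ (p 2 < k.h + R₀) := fun p hp h => by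
  have := ((k.hP₂iff p).1 hp).2.1; linarith

/-- For `R₀ ≥ 1` the two plates have no contact. -/
theorem plates_far (k : WallCell C R₀) (hR₀ : 1 ≤ R₀) : ∀ p ∈ k.P₁, ∀ q ∈ k.P₂, dist p q ≠ 1 := by
  intro p hp q hq hd
  have hp2 := ((k.hP₁iff p).1 hp).2.2.1
  have hq2 := ((k.hP₂iff q).1 hq).2.1
  have hh := k.hh
  have hcoord : |q 2 - p 2| ≤ dist q p := by
    have h1 := EuclideanSpace.dist_eq q p
    have h2 : (q 2 - p 2) ^ 2 ≤ ∑ i, dist (q i) (p i) ^ 2 := by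
      rw [Fin.sum_univ_three]
      have : dist (q 2) (p 2) ^ 2 = (q 2 - p 2) ^ 2 := by rw [Real.dist_eq, sq_abs]
      nlinarith [sq_nonneg (dist (q 0) (p 0)), sq_nonneg (dist (q 1) (p 1))]
    rw [h1]
    calc |q 2 - p 2| = Real.sqrt ((q 2 - p 2) ^ 2) := (Real.sqrt_sq_eq_abs _).symm
      _ ≤ Real.sqrt (∑ i, dist (q i) (p i) ^ 2) := Real.sqrt_le_sqrt h2
  rw [dist_comm] at hd
  rw [hd] at hcoord
  have : q 2 - p 2 ≤ 1 := le_trans (le_abs_self _) hcoord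
  linarith

end WallCell

/-! ## Placed cells -/

/-- **A PLACED WALL CELL**: a model-position `WallCell` together with the rigid motion `p ↦ M p + t` placing it in the configuration `X'`. -/
structure PlacedCell (C R₀ : ℝ) (X' : Finset E3) extends WallCell C R₀ where
  /-- the placing motion (model → actual) -/
  M : E3 ≃ₗᵢ[ℝ] E3
  t : E3
  /-- the cell's balls are balls of the configuration -/
  hX' : toWallCell.X.image (rigid M t) ⊆ X'

namespace PlacedCell

variable {C R₀ : ℝ} {X' : Finset E3}

/-- the cell's balls in actual position (these pay). -/
def act (k : PlacedCell C R₀ X') : Finset E3 := k.X.image (rigid k.M k.t)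

/-- the configuration pulled back to the cell's model position -/
def model (k : PlacedCell C R₀ X') : Finset E3 := X'.image fun p => k.M.symm (p - k.t)

/-- The placed cell's balls are balls of the configuration. -/
theorem act_subset (k : PlacedCell C R₀ X') : k.act ⊆ X' := k.hX'

/-- In model position the cell's balls lie in the pulled-back configuration. -/
theorem X_subset_model (k : PlacedCell C R₀ X') : k.X ⊆ k.model := by
  classical
  intro p hp
  unfold model
  rw [Finset.mem_image]
  exact ⟨rigid k.M k.t p, k.hX' (Finset.mem_image_of_mem _ hp), symm_rigid_apply _ _ _⟩

/-- Pushing the pulled-back configuration forward recovers it. -/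
theorem model_image (k : PlacedCell C R₀ X') : k.model.image (rigid k.M k.t) = X' := by
  classical
  unfold model
  rw [Finset.image_image]
  have : (rigid k.M k.t ∘ fun p => k.M.symm (p - k.t)) = id := by
    funext p; exact rigid_symm_apply _ _ _
  rw [this, Finset.image_id]

open scoped Classical in
/-- the cell's TILING RIM (model-side expression): half the filling's bonds leaving the cell plus half the plates' bonds to filling-like balls outside the cell. -/
def tilingRim (k : PlacedCell C R₀ X') : ℝ :=
  (crossCount k.F (k.model \ k.X) : ℝ) / 2 +
    (((k.P₁ ×ˢ (k.model \ k.X)).filter fun pq : E3 × E3 =>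
        dist pq.1 pq.2 = 1 ∧ (pq.2 ∉ stacking k.L₁ k.s₁ k.σ₁ ∨ -R₀ < pq.2 2)).card : ℝ) / 2 +
    (((k.P₂ ×ˢ (k.model \ k.X)).filter fun pq : E3 × E3 =>
        dist pq.1 pq.2 = 1 ∧ (pq.2 ∉ stacking k.L₂ k.s₂ k.σ₂ ∨ pq.2 2 < k.h + R₀)).card : ℝ) / 2

/-- **The wall-cell line, per placed cell** (`R₀ ≥ 1`): `budget ≤ Σ_{act} halfDefect X' + tilingRim`. -/
theorem budget_le (k : PlacedCell C R₀ X') (hR₀ : 1 ≤ R₀) :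
    k.budget ≤ ∑ a ∈ k.act, halfDefect X' a + k.tilingRim := by
  classical
  have hP₁S : (↑k.P₁ : Set E3) ⊆ stacking k.L₁ k.s₁ k.σ₁ := fun p hp => ((k.hP₁iff p).1 hp).1
  have hP₂S : (↑k.P₂ : Set E3) ⊆ stacking k.L₂ k.s₂ k.σ₂ := fun p hp => ((k.hP₂iff p).1 hp).1
  have hmain := wallBudget_le_sum_halfDefect k.hσ₁ k.hσ₂ (fun q => -R₀ < q 2) (fun q => q 2 < k.h + R₀)
    (X' := k.model) k.X_subset_model k.hP₁ k.hP₂ hP₁S hP₂S k.not_beyond₁ k.not_beyond₂ (k.plates_far hR₀)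
  -- transport the half-defect sum to actual position
  have hsum : ∑ a ∈ k.X, halfDefect k.model a = ∑ a ∈ k.act, halfDefect X' a := by
    unfold act
    rw [Finset.sum_image fun p _ q _ h => rigid_injective k.M k.t h]
    refine Finset.sum_congr rfl fun a _ => ?_
    rw [← halfDefect_image_rigid k.M k.t k.model a, k.model_image]
  unfold WallCell.budget tilingRim
  unfold WallCell.F at hmain ⊢
  rw [← hsum]
  linarith

end PlacedCell

end Summit.Ventures.Crystal3D.Cruxes.TextureLiminf.TexShadow

end
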